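import Mathlib

/-!
# Shy and prevalent sets (Hunt–Sauer–Yorke prevalence)

Hunt, Sauer and Yorke [HuntSauerYorke1992, §2] define a translation-invariant notion of
"Lebesgue measure zero" / "Lebesgue almost every" that makes sense on infinite-dimensional
spaces, where no (quasi-)invariant σ-finite Borel measure exists:

* a Borel measure `μ` is **transverse** to a set `S ⊆ V` (HSY Definition 1) if some compact set
  has positive finite `μ`-measure and *every translate* of `S` is `μ`-null;
* a Borel set is **shy** (HSY Definition 2) if it admits a transverse measure, an arbitrary set is
  shy if it is contained in a shy Borel set, and a set is **prevalent** if its complement is shy.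

In `ℝⁿ` shy = Lebesgue-null (HSY Fact 6); in general shy sets form a translation-invariant
σ-ideal of sets with empty interior (HSY Facts 1, 2′, 3′, 3″). The same class of sets was
introduced earlier by Christensen (1972) in abelian Polish groups under the name
**Haar null sets**.

## Main definitions

* `Literature.Analysis.Prevalence.IsTransverse μ S` — HSY Definition 1.
* `Literature.Analysis.Prevalence.IsShy S` — HSY Definition 2 (with the Borel envelope built in,
  so that it applies to arbitrary sets).
* `Literature.Analysis.Prevalence.IsPrevalent S := IsShy Sᶜ`.

## Main statements

* `IsShy.mono`, `IsShy.vadd_set` — HSY Fact 1 (subsets and translates of shy sets are shy).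
* `IsTransverse.exists_isProbabilityMeasure`, `isShy_iff_exists_isProbabilityMeasure` — HSY Fact 2,
  first half: the transverse measure may be taken to be a probability measure carried by a compact
  set (the "compactly supported probability measure" form of the definition, Robinson,
  *Dimensions, Embeddings, and Attractors*, Def. 5.1).
* `IsShy.interior_eq_empty`, `IsPrevalent.dense` — HSY Fact 2′ (prevalent sets are dense).
* `IsPrevalent.mem_residual` — a prevalent `G_δ` set is residual (Baire-generic).

## Design / generality

HSY work in a complete metric linear space. The definitions below only use the additive group,
the topology (for compactness) and the measurable structure of `V`; they are intended for
`[IsTopologicalAddGroup V] [BorelSpace V]` (so that `MeasurableSet` = Borel), complete and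
metrizable, e.g. a real Banach space. Mathlib measures are outer measures, so the clause
`∀ v, μ (v +ᵥ S) = 0` is meaningful for every set `S`; as in HSY, shyness of a non-Borel set asks
for a *single* Borel superset all of whose translates are null. Translates are written with
Mathlib's pointwise action `v +ᵥ S = {v + s | s ∈ S}` (HSY write `S + v`).

Numbering of facts follows the journal version (Bull. AMS 27 (1992)); the arXiv version
(math/9210220) numbers the same facts consecutively 1–11.

## Not in this file

Finite unions / finite intersections of prevalent sets and the finite-dimensional
characterisation (HSY Facts 3, 3′, 6: `Union.lean`), countable unions (HSY Fact 3″: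
`CountableUnion.lean`), finite-dimensional probes (HSY Definition 6: `Probe.lean`), local
shyness (HSY Definition 5) and HSY Fact 8 (compact subsets of infinite-dimensional spaces are shy).

## References

* B. R. Hunt, T. Sauer, J. A. Yorke, *Prevalence: a translation-invariant "almost every" on
  infinite-dimensional spaces*, Bull. Amer. Math. Soc. 27 (1992) 217–238, §2. [HuntSauerYorke1992]
-/

open MeasureTheory Set Filter
open scoped Pointwise ENNReal Topology

namespace Literature.Analysis.Prevalence

variable {V : Type*} [AddCommGroup V] [TopologicalSpace V] [MeasurableSpace V]

/-- **Transverse measure** (Hunt–Sauer–Yorke). A measure `μ` on `V` is *transverse* to a set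
`S ⊆ V` if (i) there is a compact set `K` with `0 < μ K < ∞`, and (ii) every translate of `S` is
`μ`-null: `μ (v +ᵥ S) = 0` for all `v : V`.
[cite: HuntSauerYorke1992, §2 Definition 1] -/
def IsTransverse (μ : Measure V) (S : Set V) : Prop :=
  (∃ K : Set V, IsCompact K ∧ 0 < μ K ∧ μ K < ∞) ∧ ∀ v : V, μ (v +ᵥ S) = 0

/-- **Shy set** (Hunt–Sauer–Yorke). A Borel set is *shy* if some measure is transverse to it; an
arbitrary set `S ⊆ V` is shy if it is contained in a shy Borel (`MeasurableSet`) set. In `ℝⁿ` this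
is "Lebesgue measure zero" (HSY Fact 6); Christensen's *Haar null sets* are the same notion.
[cite: HuntSauerYorke1992, §2 Definition 2] -/
def IsShy (S : Set V) : Prop :=
  ∃ B : Set V, S ⊆ B ∧ MeasurableSet B ∧ ∃ μ : Measure V, IsTransverse μ B

/-- **Prevalent set** (Hunt–Sauer–Yorke): a set whose complement is shy — the
translation-invariant "almost every" on infinite-dimensional spaces.
[cite: HuntSauerYorke1992, §2 Definition 2] -/
def IsPrevalent (S : Set V) : Prop :=
  IsShy Sᶜ

variable {μ : Measure V} {S T : Set V}

/-! ### Transverse measures -/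

namespace IsTransverse

/-- Condition (i) of HSY Definition 1: a compact set of positive finite measure.
[cite: HuntSauerYorke1992, §2 Definition 1] -/
theorem exists_isCompact (h : IsTransverse μ S) :
    ∃ K : Set V, IsCompact K ∧ 0 < μ K ∧ μ K < ∞ :=
  h.1

/-- Condition (ii) of HSY Definition 1: every translate is null.
[cite: HuntSauerYorke1992, §2 Definition 1] -/
theorem measure_vadd_set (h : IsTransverse μ S) (v : V) : μ (v +ᵥ S) = 0 :=
  h.2 v

/-- In particular the set itself is null for a transverse measure. [folklore] -/
theorem measure_eq_zero (h : IsTransverse μ S) : μ S = 0 := by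
  simpa only [zero_vadd] using h.2 0

/-- A transverse measure is not the zero measure (HSY: "a measure ... not identically zero").
[cite: HuntSauerYorke1992, §2 Definition 1] -/
theorem ne_zero (h : IsTransverse μ S) : μ ≠ 0 := by
  rintro rfl
  obtain ⟨K, -, hK, -⟩ := h.1
  simp at hK

/-- A measure transverse to `S` is transverse to every subset of `S` (HSY Fact 1, subsets).
[cite: HuntSauerYorke1992, §2 Fact 1] -/
theorem mono (h : IsTransverse μ S) (hT : T ⊆ S) : IsTransverse μ T :=
  ⟨h.1, fun v => measure_mono_null (vadd_set_mono hT) (h.2 v)⟩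

/-- A measure transverse to `S` is transverse to every translate of `S` (HSY Fact 1, translates).
[cite: HuntSauerYorke1992, §2 Fact 1] -/
theorem vadd_set (h : IsTransverse μ S) (w : V) : IsTransverse μ (w +ᵥ S) :=
  ⟨h.1, fun v => by rw [vadd_vadd]; exact h.2 (v + w)⟩

/-- A measure transverse to two sets is transverse to their union. [folklore] -/
theorem union (hS : IsTransverse μ S) (hT : IsTransverse μ T) : IsTransverse μ (S ∪ T) :=
  ⟨hS.1, fun v => by rw [vadd_set_union]; exact measure_union_null (hS.2 v) (hT.2 v)⟩

/-- A measure transverse to countably many sets is transverse to their union (σ-subadditivity;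
this is the trivial part of HSY Fact 3″ — the point of Fact 3″ is to find ONE measure transverse
to all the sets). [folklore] -/
theorem iUnion {ι : Sort*} [Countable ι] [Nonempty ι] {S : ι → Set V}
    (h : ∀ i, IsTransverse μ (S i)) : IsTransverse μ (⋃ i, S i) :=
  ⟨(h (Classical.arbitrary ι)).1, fun v => by
    rw [vadd_set_iUnion]
    exact measure_iUnion_null fun i => (h i).2 v⟩

/-- Transversality is invariant under rescaling the measure by a positive finite constant.
[folklore] -/
theorem smul_measure (h : IsTransverse μ S) {c : ℝ≥0∞} (hc : c ≠ 0) (hc' : c ≠ ∞) :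
    IsTransverse (c • μ) S := by
  obtain ⟨K, hK, hpos, hfin⟩ := h.1
  refine ⟨⟨K, hK, ?_, ?_⟩, fun v => ?_⟩
  · simp only [Measure.smul_apply, smul_eq_mul]
    exact ENNReal.mul_pos hc hpos.ne'
  · simp only [Measure.smul_apply, smul_eq_mul]
    exact ENNReal.mul_lt_top hc'.lt_top hfin
  · simp only [Measure.smul_apply, smul_eq_mul, h.2 v, mul_zero]

/-- Restricting a measure all of whose translates of `S` are null to a compact set of positive
finite measure gives a *finite* transverse measure carried by that compact set (HSY Fact 2, first
step of the proof). [cite: HuntSauerYorke1992, §2 Fact 2] -/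
theorem restrict (h : ∀ v : V, μ (v +ᵥ S) = 0) {K : Set V} (hK : IsCompact K) (hpos : 0 < μ K)
    (hfin : μ K < ∞) : IsTransverse (μ.restrict K) S :=
  ⟨⟨K, hK, by rwa [Measure.restrict_apply_self], by rwa [Measure.restrict_apply_self]⟩,
    fun v => (Measure.absolutelyContinuous_of_le Measure.restrict_le_self) (h v)⟩

/-- **HSY Fact 2** (first half): a set with a transverse measure has a transverse *probability*
measure carried by a compact set (`ν K = 1`). (The second half of Fact 2 — the compact set may be
taken of arbitrarily small diameter — is in `CountableUnion.lean`.)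
[cite: HuntSauerYorke1992, §2 Fact 2] -/
theorem exists_isProbabilityMeasure (h : IsTransverse μ S) :
    ∃ ν : Measure V, IsProbabilityMeasure ν ∧ IsTransverse ν S ∧
      ∃ K : Set V, IsCompact K ∧ ν K = 1 := by
  obtain ⟨K, hK, hpos, hfin⟩ := h.1
  have hK1 : ((μ K)⁻¹ • μ.restrict K) K = 1 := by
    simp only [Measure.smul_apply, smul_eq_mul, Measure.restrict_apply_self]
    exact ENNReal.inv_mul_cancel hpos.ne' hfin.ne
  refine ⟨(μ K)⁻¹ • μ.restrict K, ⟨?_⟩, ?_, K, hK, hK1⟩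
  · simp only [Measure.smul_apply, smul_eq_mul, Measure.restrict_apply_univ]
    exact ENNReal.inv_mul_cancel hpos.ne' hfin.ne
  · exact (IsTransverse.restrict h.2 hK hpos hfin).smul_measure (ENNReal.inv_ne_zero.2 hfin.ne)
      (ENNReal.inv_ne_top.2 hpos.ne')

end IsTransverse

/-! ### Shy sets -/

/-- A Borel set with a transverse measure is shy (HSY Definition 2, Borel case).
[cite: HuntSauerYorke1992, §2 Definition 2] -/
theorem IsTransverse.isShy (h : IsTransverse μ S) (hS : MeasurableSet S) : IsShy S :=
  ⟨S, Subset.rfl, hS, μ, h⟩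

/-- Every shy set (Borel or not) carries a transverse measure. [folklore] -/
theorem IsShy.exists_isTransverse (h : IsShy S) : ∃ μ : Measure V, IsTransverse μ S := by
  obtain ⟨B, hSB, -, μ, hμ⟩ := h
  exact ⟨μ, hμ.mono hSB⟩

/-- For a Borel set, shyness is the existence of a transverse measure (HSY Definition 2).
[cite: HuntSauerYorke1992, §2 Definition 2] -/
theorem isShy_iff_exists_isTransverse (hS : MeasurableSet S) :
    IsShy S ↔ ∃ μ : Measure V, IsTransverse μ S :=
  ⟨IsShy.exists_isTransverse, fun ⟨_, hμ⟩ => hμ.isShy hS⟩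

/-- The "compactly supported probability measure" form of the definition (HSY, remark after
Definition 2; Robinson, *Dimensions, Embeddings, and Attractors*, Definition 5.1): a Borel set `S`
is shy iff there is a probability measure `μ`, carried by a compact set, all of whose translates
of `S` are null. [cite: HuntSauerYorke1992, §2 Fact 2] -/
theorem isShy_iff_exists_isProbabilityMeasure (hS : MeasurableSet S) :
    IsShy S ↔ ∃ μ : Measure V, IsProbabilityMeasure μ ∧ (∃ K : Set V, IsCompact K ∧ μ K = 1) ∧
      ∀ v : V, μ (v +ᵥ S) = 0 := by
  rw [isShy_iff_exists_isTransverse hS]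
  constructor
  · rintro ⟨μ, hμ⟩
    obtain ⟨ν, hν, hνS, K, hK, hK1⟩ := hμ.exists_isProbabilityMeasure
    exact ⟨ν, hν, ⟨K, hK, hK1⟩, hνS.2⟩
  · rintro ⟨μ, -, ⟨K, hK, hK1⟩, hμ⟩
    exact ⟨μ, ⟨K, hK, by simp [hK1]⟩, hμ⟩

/-- **HSY Fact 1** (subsets): every subset of a shy set is shy.
[cite: HuntSauerYorke1992, §2 Fact 1] -/
theorem IsShy.mono (h : IsShy S) (hT : T ⊆ S) : IsShy T := by
  obtain ⟨B, hSB, hB, μ, hμ⟩ := h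
  exact ⟨B, hT.trans hSB, hB, μ, hμ⟩

/-- The empty set is shy (the Dirac mass at `0` is transverse to it). [folklore] -/
theorem isShy_empty : IsShy (∅ : Set V) := by
  refine ⟨∅, Subset.rfl, MeasurableSet.empty, Measure.dirac 0,
    ⟨{0}, isCompact_singleton, ?_, ?_⟩, fun v => by simp⟩
  · rw [Measure.dirac_apply_of_mem (mem_singleton 0)]
    exact one_pos
  · rw [Measure.dirac_apply_of_mem (mem_singleton 0)]
    exact ENNReal.one_lt_top

/-- **HSY Fact 1** (translates): every translate of a shy set is shy.
[cite: HuntSauerYorke1992, §2 Fact 1] -/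
theorem IsShy.vadd_set [MeasurableAdd V] (h : IsShy S) (v : V) : IsShy (v +ᵥ S) := by
  obtain ⟨B, hSB, hB, μ, hμ⟩ := h
  exact ⟨v +ᵥ B, vadd_set_mono hSB, hB.const_vadd v, μ, hμ.vadd_set v⟩

/-- Shyness is translation invariant. [cite: HuntSauerYorke1992, §2 Fact 1] -/
theorem isShy_vadd_set_iff [MeasurableAdd V] (v : V) : IsShy (v +ᵥ S) ↔ IsShy S :=
  ⟨fun h => by simpa only [neg_vadd_vadd] using h.vadd_set (-v), fun h => h.vadd_set v⟩

/-! ### Prevalent sets -/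

/-- Unfolding: `S` is prevalent iff `Sᶜ` is shy. [cite: HuntSauerYorke1992, §2 Definition 2] -/
theorem isPrevalent_iff : IsPrevalent S ↔ IsShy Sᶜ :=
  Iff.rfl

/-- `Sᶜ` is prevalent iff `S` is shy. [folklore] -/
@[simp] theorem isPrevalent_compl_iff : IsPrevalent Sᶜ ↔ IsShy S := by
  rw [IsPrevalent, compl_compl]

/-- The complement of a shy set is prevalent. [cite: HuntSauerYorke1992, §2 Definition 2] -/
theorem IsShy.isPrevalent_compl (h : IsShy S) : IsPrevalent Sᶜ :=
  isPrevalent_compl_iff.2 h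

/-- A superset of a prevalent set is prevalent. [cite: HuntSauerYorke1992, §2 Fact 1] -/
theorem IsPrevalent.mono (h : IsPrevalent S) (hT : S ⊆ T) : IsPrevalent T :=
  IsShy.mono h (compl_subset_compl.2 hT)

/-- The whole space is prevalent. [folklore] -/
theorem isPrevalent_univ : IsPrevalent (univ : Set V) := by
  rw [IsPrevalent, compl_univ]
  exact isShy_empty

/-- Prevalence is translation invariant. [cite: HuntSauerYorke1992, §2 Fact 1] -/
theorem IsPrevalent.vadd_set [MeasurableAdd V] (h : IsPrevalent S) (v : V) :
    IsPrevalent (v +ᵥ S) := by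
  rw [IsPrevalent, ← vadd_set_compl]
  exact IsShy.vadd_set h v

/-! ### Shy sets have empty interior; prevalent sets are dense (HSY Fact 2′) -/

section Density

variable [ContinuousAdd V]

/-- A transverse measure sees no nonempty open subset of `S`: finitely many translates of such an
open set would cover the compact set of positive measure (proof of HSY Fact 2′, which needs neither
a metric nor completeness). [cite: HuntSauerYorke1992, §2 Fact 2′] -/
theorem IsTransverse.not_subset_of_isOpen (h : IsTransverse μ S) {U : Set V} (hU : IsOpen U)
    (hne : U.Nonempty) : ¬ U ⊆ S := by
  intro hUS
  obtain ⟨K, hK, hpos, -⟩ := h.1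
  obtain ⟨o, ho⟩ := hne
  have hcover : K ⊆ ⋃ k ∈ K, (k - o) +ᵥ U := fun k hk =>
    mem_iUnion₂.2 ⟨k, hk, mem_vadd_set.2 ⟨o, ho, by simp [vadd_eq_add]⟩⟩
  obtain ⟨t, -, htfin, htsub⟩ :=
    hK.elim_finite_subcover_image (fun k _ => hU.vadd (k - o)) hcover
  refine hpos.ne' (measure_mono_null htsub ?_)
  exact (measure_biUnion_null_iff htfin.countable).2 fun k _ =>
    measure_mono_null (vadd_set_mono hUS) (h.2 _)

/-- **HSY Fact 2′** (shy form): a shy set has empty interior.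
[cite: HuntSauerYorke1992, §2 Fact 2′] -/
theorem IsShy.interior_eq_empty (h : IsShy S) : interior S = ∅ := by
  obtain ⟨B, hSB, -, μ, hμ⟩ := h
  by_contra hne
  exact hμ.not_subset_of_isOpen isOpen_interior (nonempty_iff_ne_empty.2 hne)
    (interior_subset.trans hSB)

/-- A shy set is not the whole space. [cite: HuntSauerYorke1992, §2 Fact 2′] -/
theorem IsShy.ne_univ (h : IsShy S) : S ≠ univ := by
  rintro rfl
  simpa using h.interior_eq_empty

/-- A nonempty open set is not shy. [cite: HuntSauerYorke1992, §2 Fact 2′] -/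
theorem not_isShy_of_isOpen {U : Set V} (hU : IsOpen U) (hne : U.Nonempty) : ¬ IsShy U := by
  intro h
  have := h.interior_eq_empty
  rw [hU.interior_eq] at this
  exact hne.ne_empty this

/-- **HSY Fact 2′**: all prevalent sets are dense. [cite: HuntSauerYorke1992, §2 Fact 2′] -/
theorem IsPrevalent.dense (h : IsPrevalent S) : Dense S := by
  rw [dense_iff_inter_open]
  intro U hU hne
  obtain ⟨B, hSB, -, μ, hμ⟩ := h
  by_contra h'
  refine hμ.not_subset_of_isOpen hU hne (Subset.trans ?_ hSB)
  intro x hx hxS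
  exact h' ⟨x, hx, hxS⟩

/-- A prevalent set is nonempty. [cite: HuntSauerYorke1992, §2 Fact 2′] -/
theorem IsPrevalent.nonempty (h : IsPrevalent S) : S.Nonempty :=
  h.dense.nonempty

/-- **Prevalent + `G_δ` ⇒ Baire-generic**: a prevalent `G_δ` set is residual (it is a dense `G_δ`).
In general prevalence and genericity are logically independent (HSY §1, Examples 1–6).
[folklore] -/
theorem IsPrevalent.mem_residual (h : IsPrevalent S) (hG : IsGδ S) : S ∈ residual V :=
  residual_of_dense_Gδ hG h.dense

end Density

end Literature.Analysis.Prevalence
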